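import Summits.QuantumFields.YangMills.Theorems.BalabanUVNodesN07SplitClauseHeadAtCubeDomains
import Literature.MathematicalPhysics.QuantumFieldTheory.Balaban1983to89.Node00.TorusCoverGaugeTokens152153BoxUniform
import HarnessLib

/-!
# N07 [B11] (= [15] = [Balaban1985Variational]) Sect. F, road of record R0′, S6 HEAD: **THE PER-DATUM CLAUSE AT THE PRINT DATUM WITH S3's GAUGE SUPPLIED** —
# FILE 3's `localGaugeSplitOn_head159_printCube_box` composed with n07-w3's UNIFORM door `gauge152_REfiner153_box_of_within_of_prop6P_uniform` (p626788; [6] Prop. 6 ∕ Thm 2 at the cube datum,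
# constants keyed on the CUBE letter `Mb`, the record's `M` free — n07-w3 g7's caution LOCATED-M-COUPLING I.35952:
# the Landau gauge `u`, the potential `A`, the five (152) clauses at `b9OfP·ε_n`, the (153) `RE`-clauses), so that the chart side of the S6 head becomes ONE displayed binder

Cell `pub-ymgap`, width seat `pub-ymgap-dag-n07-w4` g4 (sub-target S6 = the HEAD), CLAIM-4 ∕ INTENT-4 (cell bus I.37171).  `--kind proof --supports stmt-QuantumFields-27364 --as helper`
(K1⁹ per dag-lead KEY MAP v2); count-neutral; def-free.  [15] = [Balaban1985Variational]; [6] = [Balaban1985RegularSpaces]; [4] = [Balaban1984PropagatorsII]; [3] =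
[Balaban1985Averaging].

THE POINT.  After FILE 3 the per-datum R0′ clause at the print datum `(cornerP Mc ρ idx, sideP Mc ρ, ρ)` of a grid cube of level `K − n` displayed, besides sizes and thresholds,
S3's Landau gauge `u` of `U` with potential `A` and (152) letters `t`.  These ARE the output of n07-w3's door (generation 6, `Node00.TorusCoverGaugeTokens152153BoxUniform`) at the
SAME window for a grid cube MEETING `Ω_{K−n}` — from [6] Prop. 6 on print's class (the HYPOTHESIS `hP6`, N05's in-edge), the record's (17)∕(19) smallness at `Sup := suppDomOfRecord`,
`ε_m ≤ a0OfP F N Mb ρ B₁ c₁`, the member floor `(44 + 4ρ + Mc + Dw)·L ≤ ν.M₁`, a `Within Dw`-witness (the head tokens' meeting condition, `Dw = 3`) and the non-wrapping of the collared print cube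
(FILE 3's numerics).  THIS FILE plugs the door in: `t := b9OfP·ε_{K−n}` (the token's `κε_j`), and everything the CHART lane owes — the data `B` in print's shapes, the uniformly
small third datum `B′`, the first summand `A₁` with its letter, the Landau copy `(u♮, U₁)` with its rows, the dominated shear family `λ` and its coarse gradient `X`, and the
identity `A − H_V X = A₁ + H_V B − H_V B′` — becomes ONE binder `hchart`, universally quantified over the door's `(u, A)` and their six output clauses, with the SIZE LETTERS
`β₁ β₂ s′ v_j a_j σ t₁` fixed OUTSIDE (uniform in the gauge, as the budget needs).  Conclusion: `LocalGaugeSplitOn (π '' □) η_{K−n} (b9OfP·ε_{K−n}) (t₁ + (t₂ + t_∂) + t₃) U`.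

WHAT IS PROVED (sorry-free; no definition; axioms standard).  ★★★ `localGaugeSplitOn_head159_printCube_of_prop6P F N` (statement above).
HONEST SCOPE.  Count-neutral by-name composition (FILE 3 p630546 ∘ n07-w3 p626788 `gauge152_REfiner153_box_of_within_of_prop6P_uniform`); [6] Prop. 6 is a HYPOTHESIS; `hchart` (the
chart lane's deliverable: k0-s1-w1∕w2, n07-w2, n07-w6∕w7, data n07-w5), the size letters, `H_V`'s kernel formula, the floors and thresholds are DISPLAYED, not discharged;
nothing of [15]∕[6]∕[4]∕[3] ANALYSIS asserted; `LocalLettersSplitTopStepCore(G∕R)` ∕ `DatumGaugeSplitTopStepCore(G∕R)` ∕ `HalvingStepTop(Core)` ∕ `stub_prop8StepCoP13` NOT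
discharged; K0⁷ ∕ K1⁹ NOT closed; N07 ∕ N05 NOT discharged; counts unmoved (typed 28∕28 · discharged 5∕27); one finite 𝕋⁴ programme at fixed ε — the route closes the
conditional finite-𝕋⁴ rung `BalabanLadder.UV` ONLY; the YM mass gap (Clay) is NOT proved by any of this; nothing continuum ∕ ℝ⁴ ∕ OS.  No `sorry`, no `def`, no `instance`,
no `notation`.

RELATED IN THE TREE, NOT DUPLICATED: FILE 3 `N07SplitClauseHeadAtCubeDomains` and n07-w3 `Node00.TorusCoverGaugeTokens152153BoxUniform` — CONSUMED BY NAME; n07-w3 g7's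
`Thm/BalabanUVNodesN07DatumGauge152Guarded` (the same door under the plan's V20-G guard — the KNIT keys on it, next file); dag-n07-w4 g3
`N07LocalLettersCoreGuarded.DatumGaugeSplitTopStepCoreG` (the token this clause instantiates per datum — NOT discharged here: the ∀-intro over datums and the budget remain).

References: [15] (144) p. 300, (150)–(153) p. 301, (157)–(159) pp. 302–303, (164)–(165) p. 304, (168) p. 304; [6] Prop. 6 (1.135)–(1.138) p. 99, p. 98, (1.131) p. 99;
[4] (2.1)–(2.4) p. 224, (2.7) p. 224, (2.10)–(2.12) p. 225, Cor. 2.8 (2.150)–(2.151) p. 249; [3] (85)–(88) p. 31.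
-/

set_option autoImplicit false

noncomputable section
open scoped BigOperators Matrix.Norms.L2Operator

namespace Summit.QuantumFields.YangMills.BalabanUVNodes.N07SplitClauseHeadOfProp6P

open Literature.MathematicalPhysics.QuantumFieldTheory.Balaban1983to89
open Literature.MathematicalPhysics.QuantumFieldTheory.Balaban1983to89.Node00
open Literature.MathematicalPhysics.QuantumFieldTheory.Balaban1983to89.B12RegularSpaces111 (gaugeU expI grad)
open B15Eq112TorusCover (cover)
open B14DomainGeom (Pt Within)
open B14.Eq213MaximalDomains (side cubeExt)
open B5Eq117TorusCarriers (Mk)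
open B5Eq118OneStroke (iterBlockOf)
open B5Prop12FieldsLattice (distSite)
open B8Eq131Cubes (sqLo sqHi box cube)
open B8LeafModelZd (ZdIdx)
open B11Eq115Space (levOf)
open B6SectADomainsV1 (Domains)
open B6SectAOperatorsV1 (BondIdx RE dsE QpE)
open Literature.MathematicalPhysics.QuantumFieldTheory.BalabanImbrieJaffe1984to88.BIJ85AxialPropagator411 (BondSpace)
open T4Continuum (T4Family)
open T4AxialGaugeSmallField (castSite)
open B16Sect1Backgrounds (toMS)
open GaugeField (gaugeAct)
open MatrixLog (mlog)
open Summit.QuantumFields.YangMills.Theorems.FlatCubeOpsText (Adm22 distBI)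
open Summit.QuantumFields.YangMills.Theorems.K0FlatCubeOpsTextP (flatH IsLevWeight)
open Summit.QuantumFields.YangMills.BalabanUVNodes.N07HalvingStepTopOfLocalLetters (Letters10On)
open Summit.QuantumFields.YangMills.BalabanUVNodes.N07LocalLettersSplitCore (LocalGaugeSplitOn)
open Summit.QuantumFields.YangMills.BalabanUVNodes.N07SplitClauseHeadAtCubeDomains (localGaugeSplitOn_head159_printCube_box)

open scoped Classical in
/-- ★★★ **THE PER-DATUM CLAUSE AT THE PRINT DATUM WITH S3's GAUGE SUPPLIED** (statement in the header): FILE 3's `localGaugeSplitOn_head159_printCube_box` ∘ n07-w3's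
`gauge152_REfiner153_box_of_within_of_prop6P_uniform` (constants on the cube letter `Mb`, the record's `M` free); displayed: [6] Prop 6 (`hP6`), the record's sequence ∕ letters ∕ (17)∕(19) data, the meeting witness and floors, the numerics of
the print datum, `H_V`'s kernel formula, the canonical boxes, the size letters, and the chart side as ONE binder `hchart`; conclusion
`LocalGaugeSplitOn (π '' □) η_{K−n} (b9OfP·ε_{K−n}) (t₁ + (t₂ + t_∂) + t₃) U`.
[cite: Balaban1985Variational, (144) p.300, (150)–(153) p.301, (157)–(159) pp.302–303, (164)–(165) p.304, (168) p.304; Balaban1985RegularSpaces, Prop. 6 (1.135)–(1.138) p.99, p.98; Balaban1984PropagatorsII, (2.1)–(2.4) p.224, (2.10)–(2.12) p.225, Cor. 2.8 (2.150)–(2.151) p.249; Balaban1985Averaging, (85)–(88) p.31] -/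
theorem localGaugeSplitOn_head159_printCube_of_prop6P (F : T4Family) (N : ℕ) [NeZero N] :
    ∃ (Mh₀ R₀ : ℕ) (CS BS CH δH BH : ℝ), 0 ≤ CS ∧ 0 < BS ∧ 0 ≤ CH ∧ 0 < δH ∧ 0 < BH ∧
    ∀ (n K : ℕ) (_ : 1 ≤ K - n) (_ : K - n + 1 ≤ F.m + K) (hk : K - n ≤ (F.P K).m + (F.P K).K)
      {Mh R a' : ℕ} (_ : Mh = F.L ^ a') (_ : Mh₀ ≤ Mh) (_ : R₀ ≤ R) (_ : a' + 3 ≤ F.m + n)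
      -- [6] Prop 6 on print's class (N05's in-edge) — the HYPOTHESIS; the class letters `B₁ c₁`, collar `ρ`; the basic CUBE letter `Mb` of the constants (the record's `M` free)
      {B₁ c₁ : ℝ} (_ : 0 ≤ B₁) (_ : 0 < c₁) {ρ : ℕ}
      (_ : letI : CStarAlgebra (MatA N) := {}; B8.Prop6Printed 4 (F.L : ℝ) B₁ c₁ (fun i : ZdIdx 4 F.L => zdCubP (MatA N) F.L ρ i)) {Mb : ℕ} (_ : 1 ≤ Mb)
      -- the record's sequence (any `M`), smallness letters, field; the (17)∕(19) data of the head tokens at `Sup := suppDomOfRecord`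
      (ν : Stage7Numerics) {M : ℕ} (g : ℕ → ℝ) (k : ℕ) (hLρ : (F.P K).L ≤ ρ) (s : SeqOfRecord F ν M g K k) (_ : Sect2.SeqSeparated ν.M₁ s)
      (ε : ℕ → ℝ) (_ : ∀ m, m ≤ k → 0 < ε m ∧ ε m ≤ a0OfP F N Mb ρ B₁ c₁) (_ : ∀ m, m < k → ε m ≤ 2 * ε (m + 1))
      (U : GaugeField (F.P K) 0 (SU N))
      (_ : ∀ m, m ≤ k → PlaqSmallOn (Sect2.omegaPlaqsTop s.Ω (suppDomOfRecord F ν K s.Ω) m) (ε m * (F.P K).eta m ^ 2) U)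
      (_ : ∀ m, m ≤ k → Sect2.CoDivSmallOn (Sect2.omegaBondsTop s.Ω (suppDomOfRecord F ν K s.Ω) m) (ε m * (F.P K).eta m ^ 3) U)
      (_ : K - n ≤ k)
      -- the grid cube `(Mc, idx)` of level `K − n` (`Mc ∈ {Mb, L·Mb}`) MEETING `Ω_{K−n}` within `Dw`, the member floor, the numerics of the print datum
      {Mc : ℕ} (_ : Mc = Mb ∨ Mc = F.L * Mb) {Dw : ℕ} (_ : (11 * 4 + 4 * ρ + Mc + Dw) * F.L ≤ ν.M₁) (idx : Pt (F.P K).d) {x y : Pt (F.P K).d}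
      (_ : x ∈ cubeExt (side (F.P K).L Mc (K - n)) idx 0) (_ : cover (F.P K) y ∈ s.Ω (K - n)) (_ : Within (Dw : ℤ) x y)
      (_ : F.L * Mh ∣ ρ) (_ : R * (F.L * Mh) ≤ ρ) (_ : Mc + 11 * (F.P K).d + 6 * ρ ≤ (F.P K).sitesPerDir (K - n))
      {HV : (BondIdx (cubeDomains (F.P K) (cornerP (F.P K) Mc ρ idx) (sideP (F.P K) Mc ρ) ρ (K - n) hk) → MatA N) →ₗ[ℂ] (PBond (F.P K) 0 → MatA N)}
      (_ : ∀ (B : BondIdx (cubeDomains (F.P K) (cornerP (F.P K) Mc ρ idx) (sideP (F.P K) Mc ρ) ρ (K - n) hk) → MatA N) (b : PBond (F.P K) 0),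
        HV B b = ∑ c, ((flatH (F.P K) (K - n) (cubeDomains (F.P K) (cornerP (F.P K) Mc ρ idx) (sideP (F.P K) Mc ρ) ρ (K - n) hk) (Pi.single c 1) b : ℝ) : ℂ) • B c)
      -- the SIZE LETTERS of the chart side, uniform in the gauge: data (160)∕(155) `β₁ β₂`, (163)-type `θ`, third summand `s′`
      {β₁ β₂ θ s' : ℝ} (_ : 0 ≤ β₁) (_ : 0 ≤ β₂) (_ : 8 * CH * BH * Real.exp (-(δH * (ρ : ℝ))) ≤ θ) (_ : 0 ≤ s')
      -- the CANONICAL level boxes of the tower (four equation binders)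
      {lo hi : ℕ → Pt (F.P K).d}
      (_ : lo 0 = fun i => ((F.P K).L : ℤ) * (sqLo (F.P K).L (cornerP (F.P K) Mc ρ idx) ρ (K - n) 1 i - 1))
      (_ : hi 0 = fun i => ((F.P K).L : ℤ) * (sqHi (F.P K).L (cornerP (F.P K) Mc ρ idx) (sideP (F.P K) Mc ρ) ρ (K - n) 1 i + 1) + (((F.P K).L : ℤ) - 1))
      (_ : ∀ j, 1 ≤ j → lo j = sqLo (F.P K).L (cornerP (F.P K) Mc ρ idx) ρ (K - n) j - 1) (_ : ∀ j, 1 ≤ j → hi j = sqHi (F.P K).L (cornerP (F.P K) Mc ρ idx) (sideP (F.P K) Mc ρ) ρ (K - n) j + 1)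
      -- the per-level row letters and `σ` (uniform in the gauge), the first summand's letter `t₁`
      (v av : ℕ → ℝ) {σ t₁ : ℝ} (_ : ∀ j, 0 ≤ v j) (_ : ∀ j, 0 ≤ av j) (_ : σ ≤ 1 / 2)
      (_ : ∀ j ≤ K - n, (((F.P K).d * ((sideP (F.P K) Mc ρ + 4 * ρ + 3) * (F.P K).L ^ ((K - n) - j)) : ℕ) : ℝ) * (v j + av j) ≤ σ)
      -- ★ THE CHART SIDE AS ONE BINDER: for every Landau gauge `u` of `U` on the window with potential `A` obeying the five (152) clauses at `b9OfP·ε_{K−n}` and the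
      -- (153) `RE`-clauses at every kernel-finer family (= n07-w3's door's OUTPUT), the (159) objects with the sizes above
      (_ : ∀ (u : GaugeTransf (F.P K) 0 (SU N)) (A : PBond (F.P K) 0 → MatA N),
        (∀ b ∈ (Sect2.regionOfSet (F.P K) (cover (F.P K) '' box (F.P K).L (cornerP (F.P K) Mc ρ idx) (sideP (F.P K) Mc ρ) (K - n))).bonds, gaugeU (fun x => ιSU N (u x)) (fun b' => ιSU N (U b')) b = expI ((F.P K).eta (K - n)) (A b)) →
        (∀ b ∈ (Sect2.regionOfSet (F.P K) (cover (F.P K) '' box (F.P K).L (cornerP (F.P K) Mc ρ idx) (sideP (F.P K) Mc ρ) (K - n))).bonds, ‖A b‖ < b9OfP F Mb ρ B₁ * ε (K - n)) →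
        (∀ q ∈ (Sect2.regionOfSet (F.P K) (cover (F.P K) '' box (F.P K).L (cornerP (F.P K) Mc ρ idx) (sideP (F.P K) Mc ρ) (K - n))).dpairs, ‖grad ((F.P K).eta (K - n)) q.2.1 (fun y => A ⟨y, q.2.2⟩) q.1‖ < b9OfP F Mb ρ B₁ * ε (K - n)) →
        (∀ b ∈ Sect2.bondsDeep (cover (F.P K) '' box (F.P K).L (cornerP (F.P K) Mc ρ idx) (sideP (F.P K) Mc ρ) (K - n)), ‖Sect2.codiffCurlA ((F.P K).eta (K - n)) A b.src b.dir‖ < b9OfP F Mb ρ B₁ * ε (K - n)) →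
        (∀ b ∈ Sect2.bondsDeep (cover (F.P K) '' box (F.P K).L (cornerP (F.P K) Mc ρ idx) (sideP (F.P K) Mc ρ) (K - n)),
          ‖∑ ν' : Fin (F.P K).d, (((F.P K).eta (K - n) : ℝ) : ℂ)⁻¹ •
              (grad ((F.P K).eta (K - n)) ν' (fun y => A ⟨y, b.dir⟩) (b.src.unshift ν') - grad ((F.P K).eta (K - n)) ν' (fun y => A ⟨y, b.dir⟩) b.src)‖ <
            b9OfP F Mb ρ B₁ * ε (K - n)) →
        (∀ D' : Domains (F.P K), LinearMap.ker (QpE D') ≤ LinearMap.ker (QpE (cubeDomains (F.P K) (cornerP (F.P K) Mc ρ idx) (sideP (F.P K) Mc ρ) ρ (K - n) hk)) → ∀ φ : MatA N →L[ℂ] ℂ,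
          RE D' ((F.P K).eta (K - n))⁻¹ (dsE ((F.P K).eta (K - n))⁻¹ (WithLp.toLp 2 fun b => (φ (A b)).re : BondSpace (F.P K))) = 0 ∧
          RE D' ((F.P K).eta (K - n))⁻¹ (dsE ((F.P K).eta (K - n))⁻¹ (WithLp.toLp 2 fun b => (φ (A b)).im : BondSpace (F.P K))) = 0) →
        ∃ (xc : Pt (F.P K).d) (B B' : BondIdx (cubeDomains (F.P K) (cornerP (F.P K) Mc ρ idx) (sideP (F.P K) Mc ρ) ρ (K - n) hk) → MatA N) (A₁ : PBond (F.P K) 0 → MatA N)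
          (uL : GaugeTransf (F.P K) 0 (SU N)) (U₁ : GaugeField (F.P K) 0 (SU N)) (lam : (j : ℕ) → Site (F.P K) j → MatA N) (X : BondIdx (cubeDomains (F.P K) (cornerP (F.P K) Mc ρ idx) (sideP (F.P K) Mc ρ) ρ (K - n) hk) → MatA N),
          xc ∈ box (F.P K).L (cornerP (F.P K) Mc ρ idx) (sideP (F.P K) Mc ρ) (K - n) ∧
          (∀ c : BondIdx (cubeDomains (F.P K) (cornerP (F.P K) Mc ρ idx) (sideP (F.P K) Mc ρ) ρ (K - n) hk), (c.1.1 : ℕ) = K - n → ‖B c‖ ≤ β₁ * (distSite (Mk (F.P K) (c.1.1 : ℕ)) c.1.2.src (iterBlockOf (c.1.1 : ℕ) (cover (F.P K) xc)) + 1)) ∧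
          (∀ c : BondIdx (cubeDomains (F.P K) (cornerP (F.P K) Mc ρ idx) (sideP (F.P K) Mc ρ) ρ (K - n) hk), (c.1.1 : ℕ) < K - n → ‖B c‖ ≤ β₂) ∧
          (∀ c, ‖B' c‖ ≤ s') ∧
          (∀ j ≤ K - n, ∀ c : PBond (F.P K) j, c.src ∈ (castSite '' Set.Icc (lo j) (hi j) : Set (Site (F.P K) j)) →
            c.tgt ∈ (castSite '' Set.Icc (lo j) (hi j) : Set (Site (F.P K) j)) → dist1 (Averaging.iter (avOfRecord F N K) j (gaugeAct uL U₁) c) ≤ v j) ∧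
          (∀ j ≤ K - n, ∀ c : PBond (F.P K) j, c.src ∈ (castSite '' Set.Icc (lo j) (hi j) : Set (Site (F.P K) j)) →
            c.tgt ∈ (castSite '' Set.Icc (lo j) (hi j) : Set (Site (F.P K) j)) → dist1 (Averaging.iter (avOfRecord F N K) j U₁ c) ≤ av j) ∧
          (∀ (j : ℕ) (y : Site (F.P K) j), ‖lam j y‖ ≤ ‖mlog (((((toMS uL j (castSite (lo j)))⁻¹ * toMS uL j y)⁻¹ : SU N)) : MatA N)‖) ∧
          (∀ c : BondIdx (cubeDomains (F.P K) (cornerP (F.P K) Mc ρ idx) (sideP (F.P K) Mc ρ) ρ (K - n) hk), X c = LatticeFieldCalculus.grad (((F.P K).L : ℝ) ^ (K - n) / ((F.P K).L : ℝ) ^ (c.1.1 : ℕ)) (lam c.1.1) c.1.2) ∧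
          Letters10On (cover (F.P K) '' box (F.P K).L (cornerP (F.P K) Mc ρ idx) (sideP (F.P K) Mc ρ) (K - n)) ((F.P K).eta (K - n)) t₁ A₁ ∧
          (∀ b, A b - HV X b = A₁ b + HV B b - HV B' b))
      -- thresholds in the doors' currencies
      {t₂ t₃ tD : ℝ} (_ : 1 / 4 * ((sideP (F.P K) Mc ρ : ℕ) : ℝ) * max (4 * CH * BH * β₁) (θ * (β₂ / ((sideP (F.P K) Mc ρ : ℕ) : ℝ))) < t₂) (_ : 1 / 4 * max (4 * CH * BH * s') (θ * s') < t₃)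
      (_ : 2 * CS * BS * (4 * σ) < tD),
      LocalGaugeSplitOn (cover (F.P K) '' box (F.P K).L (cornerP (F.P K) Mc ρ idx) (sideP (F.P K) Mc ρ) (K - n)) ((F.P K).eta (K - n)) (b9OfP F Mb ρ B₁ * ε (K - n))
        (t₁ + (t₂ + tD) + t₃) U := by
  obtain ⟨Mh₀, R₀, CS, BS, CH, δH, BH, hCS, hBS, hCH, hδH, hBH, hmain⟩ := localGaugeSplitOn_head159_printCube_box F N
  refine ⟨Mh₀, R₀, CS, BS, CH, δH, BH, hCS, hBS, hCH, hδH, hBH, ?_⟩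
  intro n K hk1 hk' hk Mh R a' hMha hMh hR hsize B₁ c₁ hB₁ hc₁ ρ hP6 Mb hMb ν M g k hLρ s hsep ε hε hcomp U h17 h19 hnk Mc hMc Dw hfloor idx x y hx hy hxy
    hdvd hRρ hw HV hHV β₁ β₂ θ s' hβ₁ hβ₂ h163 hs' lo hi hlo0 hhi0 hloj hhij v av σ t₁ hv0 ha0 hσ hDσ hchart t₂ t₃ tD ht₂ ht₃ htD
  -- the non-wrapping of the collared print cube (k0-s1-w3's numerics, from the torus-size floor)
  obtain ⟨-, -, -, -, hinj⟩ := Summit.QuantumFields.YangMills.Theorems.K0S5CollarNumerics.numerics_propCubeP F hk1 hk hMha (by omega) hLρ hdvd idx hw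
  -- S3's door at the print datum of the grid cube: the Landau gauge `u`, the potential `A`, the five (152) clauses and the (153) `RE`-clauses
  obtain ⟨u, A, he, hA, hdA, hcd, hlap, hRE⟩ := gauge152_REfiner153_box_of_within_of_prop6P_uniform (F := F) (N := N) hB₁ hc₁ hP6 hMb ν g K k hLρ s hsep ε hε hcomp U
    h17 h19 hk1 hnk hk hMc hfloor idx hx hy hxy hinj
  -- the chart side at this gauge
  obtain ⟨xc, B, B', A₁, uL, U₁, lam, X, hxc, hX₁, hX₂, hB', hv, hav, hlam, hX, h₁, h159⟩ := hchart u A he hA hdA hcd hlap hRE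
  exact hmain n K hk1 hk' hk hMha hMh hR hsize hLρ hdvd hRρ hw hHV hxc hβ₁ hβ₂ h163 hX₁ hX₂ hs' hB' hlo0 hhi0 hloj hhij uL U₁ v av hv0 ha0 hσ hDσ hv hav lam
    hlam hX u he hA hdA h₁ h159 ht₂ ht₃ htD

end Summit.QuantumFields.YangMills.BalabanUVNodes.N07SplitClauseHeadOfProp6P

end
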